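import Summits.CriticalPhenomena.PercolationContinuityZ3.Theorems.Transplant.Slab111HubShapeLink4
import Summits.CriticalPhenomena.PercolationContinuityZ3.Theorems.Transplant.Slab111HubShapeT13
import HarnessLib

/-!
# The HUB ROUTING of the `(111)`-films — the SHAPE `T01` (block types t_R = 0, t_D = 1, s_R ≥ 3, s_D ≥ s_R)

builds on p205010 (kernel theorem, internal audit signed; external expert review pending) — NOT used in this file.  Lane `prim-bschramm`, seat
`prim-bschramm-p2` (gen 36; class C1b; memo `HOME/bschramm/P2-LATTICES.md` §131); helper file (`--supports stmt-CriticalPhenomena-4575 --as helper`).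
Machine-generated by the seat's `emit_shape.py` from `gen_tables7.make_shape` (radius 3, policy C): the cleared columns (hexagon `∩` big block), the boundary
columns dropped at level `0` / `k` (dead ends, certifiably enclosed exits, `E`-positions of `PR`-degree `≤ 1` — iterated), the window and region
predicates; **`shapeT01_valid`**: «Slab111HubShape».`ShapeB.Valid` for every block type of the family.
[cite: DuminilCopinSidoraviciusTassion2016, §2.3 (proof of Fact 2: the three disjoint paths γ_u, γ_v, γ_w in B_R(z))]
-/

namespace Summit.CriticalPhenomena.PercolationContinuityZ3.Theorems.Transplant

namespace Slab111

/-- **The shape `T01`.** [folklore] -/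
def shapeT01 : ShapeB where
  colsB := fun q => ([(0, 0), (1, 0), (0, -1), (-1, 1), (-1, 0), (0, 1), (1, -1), (0, -2), (-2, 2), (-2, 0), (0, 2), (1, 1), (1, -2), (-1, -1), (-2, 1), (-1, 2), (-3, 1), (-3, 2), (-2, -1), (-2, 3), (-1, -2), (-1, 3), (1, -3), (1, 2)] : List (ℤ × ℤ)).elem q
  badBot := fun q => ([(-3, 1), (-3, 2), (-2, -1), (-2, 2), (-2, 3), (-1, -2), (-1, 3), (0, -2), (1, -3)] : List (ℤ × ℤ)).elem q
  badTop := fun q => ([(-3, 1), (-3, 2), (-2, -1), (-2, 0), (-2, 3), (-1, -2), (-1, 3), (0, 2), (1, 2)] : List (ℤ × ℤ)).elem q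
  inwinB := fun q => decide (q.1 ≤ (1 : ℤ))
  pcB := fun q => ([(0, 0), (0, -1), (-1, 1), (-1, 0), (0, 1), (0, -2), (-2, 2), (-2, 0), (0, 2), (-1, -1), (-2, 1), (-1, 2), (-3, 1), (-3, 2), (-2, -1), (-2, 3), (-1, -2), (-1, 3)] : List (ℤ × ℤ)).elem q
  cols := [(0, 0), (1, 0), (0, -1), (-1, 1), (-1, 0), (0, 1), (1, -1), (0, -2), (-2, 2), (-2, 0), (0, 2), (1, 1), (1, -2), (-1, -1), (-2, 1), (-1, 2), (-3, 1), (-3, 2), (-2, -1), (-2, 3), (-1, -2), (-1, 3), (1, -3), (1, 2)]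

/-- The finite facts about the columns of the shape (checked by `decide`). [folklore] -/
theorem shapeT01_facts :
    (∀ q ∈ shapeT01.cols, tnZ q ≤ 3 ∧ q.1 ≤ 1 ∧ q.1 + q.2 ≤ 3 ∧ (shapeT01.pcB q = true ↔ (q.1 ≤ 0 ∧ q.1 + q.2 ≤ 3))) ∧
    (∀ q ∈ ([(0, 0), (1, 0), (0, -1), (-1, 1), (-1, 0), (0, 1), (1, -1)] : List (ℤ × ℤ)), q.1 ≤ 1 ∧ q.1 + q.2 ≤ 1 ∧
      ((q.1 ≤ 1 ∧ q.1 + q.2 ≤ 3) → shapeT01.colsB q = true ∧ shapeT01.badBot q = false ∧ shapeT01.badTop q = false)) ∧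
    (∀ q : ℤ × ℤ, shapeT01.pcB q = true → shapeT01.colsB q = true) := by
  refine ⟨by decide, by decide, fun q h => ?_⟩
  unfold shapeT01 at h ⊢
  simp only [List.elem_eq_mem, decide_eq_true_eq] at h ⊢
  revert h; revert q; decide

/-- **Validity of the shape `T01`** for every block type of its family. [folklore] -/
theorem shapeT01_valid {tD sR sD : ℕ} (htD : tD = 1) (hsR : 3 ≤ sR) (hsD : sR ≤ sD) : shapeT01.Valid 0 tD sR sD := by
  obtain ⟨F1, F2, F3⟩ := shapeT01_facts
  refine ⟨fun q hq => ?_, fun q ht hD => ?_, fun q => ?_, fun q h1 h2 => ?_, fun q hq => ?_⟩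
  · have hm : q ∈ shapeT01.cols := by unfold shapeT01 at hq ⊢; simpa [List.elem_eq_mem] using hq
    obtain ⟨a, b, c, -⟩ := F1 q hm
    unfold inBlkB; simp only [Bool.and_eq_true, decide_eq_true_eq]; refine ⟨⟨a, ?_⟩, ?_⟩ <;> omega
  · have hm := mem_hex1_of_tnZ_T13 ht
    obtain ⟨b1, b2, himp⟩ := F2 q hm
    unfold inBlkB at hD; simp only [Bool.and_eq_true, decide_eq_true_eq] at hD
    obtain ⟨⟨-, hD1⟩, hD2⟩ := hD
    exact himp ⟨by omega, by omega⟩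
  · constructor
    · intro hp
      have hc := F3 q hp
      have hm : q ∈ shapeT01.cols := by unfold shapeT01 at hc ⊢; simpa [List.elem_eq_mem] using hc
      obtain ⟨a, b, c, hiff⟩ := F1 q hm
      refine ⟨hc, ?_⟩
      have := hiff.1 hp
      unfold inBlkB; simp only [Bool.and_eq_true, decide_eq_true_eq]; refine ⟨⟨a, ?_⟩, ?_⟩ <;> omega
    · rintro ⟨hc, hb⟩
      have hm : q ∈ shapeT01.cols := by unfold shapeT01 at hc ⊢; simpa [List.elem_eq_mem] using hc
      obtain ⟨a, b, c, hiff⟩ := F1 q hm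
      unfold inBlkB at hb; simp only [Bool.and_eq_true, decide_eq_true_eq] at hb
      exact hiff.2 ⟨by omega, by omega⟩
  · exact by unfold shapeT01; simp only [decide_eq_true_eq]; omega
  · unfold shapeT01 at hq ⊢; simpa [List.elem_eq_mem] using hq

end Slab111

end Summit.CriticalPhenomena.PercolationContinuityZ3.Theorems.Transplant
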